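import Summits.QuantumFields.YangMills.Theorems.BalabanUVNodesN15ColouredExactDressingLetters
import HarnessLib

/-!
# N15 = NE2 — Σ-col (J-c′): THE COLOURED SITE OBJECT `S = b·1 + Δ^{(n)}⊗1 + exDress b (Δ^{(n)}⊗1) Z`, ITS HONEST DICTIONARY `S = (Sym unitBondMatC((Q⊗1)X(Q*⊗1)))⁻¹`, AND ITS
# η-DIFFERENCE LETTER FROM THE THREE LETTERS OF THE MIDDLE FACTOR (generic in the torus, the colour type, the levels and the middle factors)
# (dag-n15-a g29, programme Σ-col, FILE (J-c′); node N15 = NE2; `--supports stmt-QuantumFields-27366 --as helper`, count-neutral; one plumbing `def` + theorems)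

WHY.  The SITE layer of [B9] (the (3.132)-type object `(Q G(U) Q*)⁻¹`) on a COLOURED unit-bond carrier is, in position space, Bałaban's (1.102)–(1.103) map with colour: with
`unitBondMatC((Q⊗1)X(Q*⊗1)) = unitBondMatC((QGQ*)⊗1) + Z` and `(unitBondMatC((QGQ*)⊗1))⁻¹ = (b·1 + Δ^{(n)}) ⊗ₖ 1` ((G) `inv_unitBondMatC_tensorId_sOp`), the exact inverse of the symmetrised
bond matrix is `b·1 + Δ^{(n)}⊗1 + exDress b (Δ^{(n)}⊗1) Z` (V-B `exDress`).  Σ-col (H) `exDress_deltaCol_letters` gives the letters of the dressing; (G) `kernelRate166_col` those of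
`Δ^{(n)}⊗1`.  This file packages OBJECT + DICTIONARY + the η-DIFFERENCE LETTER of the object, generically — the consumer (FILE (J-c), dag-n15-c's live family) plugs in its middle
factors AND IMPOSES (H)'s EXPLICIT SMALLNESS BINDER `ζ ≤ ζ₀(d, b, δ_Z, N_c)` on its field (for (J-c) p705896: the extra condition `K_Z·κ_e·r_A ≤ ζ₀` beyond (J-b)'s `R₀`, carried by
`NE2PlusSite`'s size∕field guard `L^m·α₀ ≤ a₀` through `a_ζ := ζ₀ ∕ (K_Z(κ_e+1)c₃₅)` — an explicit binder, not a hidden estimate; v1.0.1 doc-only edition answering ref-B READ-982's one ask,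
declarations byte-identical).  Stated over (H)'s context only, so that no instance term of the coloured index is re-elaborated downstream (g28 lesson).

WHAT.  §1 def `siteC M ι n b Z`, `siteC_apply`, `inv_smul_one_add_deltaCol`, `isUnit_det_smul_one_add_deltaCol`, ★★ `siteC_eq_inv_symPart` (ANY `X`: `siteC … (unitBondMatC((Q⊗1)∘(X − G⊗1)∘(Q*⊗1)))
= (Sym unitBondMatC((Q⊗1)∘X∘(Q*⊗1)))⁻¹`), `siteC_zero`.  §2 ★★★ `siteC_sub_letters (d) (N_c) (hb) (hδZ) : ∃ C δ ζ₀ > 0, ∀ M ι (|ι| ≤ N_c) n₁ n₂ R Z Z′ ζ τ, letters (i)(ii)(iii) of Z, Z′, Z′ − Z ⟹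
∀ p q, |siteC M ι n₂ b Z′ p q − siteC M ι n₁ b Z p q| ≤ C·(τ + n₁⁻¹)·e^{−δ·cdist}` (the `b·1` cancel; (H) (iii) + (G)).
Honest label: linear algebra + bookkeeping over landed rows; NO layer of NE2 proved here; no count. [cite: Balaban1984PropagatorsI, (1.65)–(1.66) p.29, (1.102)–(1.103) p.34;
Balaban1985BackgroundPropagators, (3.132) p.422 (object, shape); King1986, Lemma 4.5 (4.38)–(4.41) pp.674–675 (mechanism); CombesThomas1973, §II (mechanism)]
-/

noncomputable section

open scoped BigOperators Matrix Kronecker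

namespace Summit.QuantumFields.YangMills.BalabanUVNodes.N15.UnitLayerBgCol

open Literature.MathematicalPhysics.QuantumFieldTheory.Balaban1983to89
open Literature.MathematicalPhysics.QuantumFieldTheory.King1986 (exp_decay_mono)
open Literature.MathematicalPhysics.QuantumFieldTheory.Balaban1983to89.B5Prop11Plancherel (Tor fine)
open Literature.MathematicalPhysics.QuantumFieldTheory.Balaban1983to89.B6Lemma24Torus (pbox)
open Literature.MathematicalPhysics.QuantumFieldTheory.Balaban1983to89.B6Cov2156Torus (deltaPol one_le_M)
open Summit.QuantumFields.YangMills.BalabanUVNodes.N15.VectorPiece (tensorId)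
open Summit.QuantumFields.YangMills.BalabanUVNodes.N15.TwoGrid (gOp qvRe qvAdjRe)
open Summit.QuantumFields.YangMills.BalabanUVNodes.N15.UnitLayerBg (sOp sOp_def exDress exDress_zero symPart symPart_apply unitBondMat_sOp_isSymm)

variable {d : ℕ}

/-! ## §1 The coloured site object and its honest dictionary -/

section Object

variable (M : Fin (d + 1) → ℕ) [∀ μ, NeZero (M μ)] (ι : Type) [Fintype ι] [DecidableEq ι] (n : ℕ) [NeZero n] (b : ℝ)

omit [NeZero n] in
/-- **THE COLOURED SITE OBJECT** at fineness `n`, averaging constant `b` and middle factor `Z` on the coloured unit bonds: `S := b·1 + Δ^{(n)} ⊗ₖ 1 + exDress b (Δ^{(n)} ⊗ₖ 1) Z`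
— the (1.66) matrix ⊗ colour, exactly dressed (V-B `exDress`; Σ-col (H)'s object). [cite: Balaban1984PropagatorsI, (1.65)–(1.66) p.29, (1.102)–(1.103) p.34 (objects)] -/
def siteC (Z : Matrix (B4.Idx (pbox M) (d + 1) × ι) (B4.Idx (pbox M) (d + 1) × ι) ℝ) : Matrix (B4.Idx (pbox M) (d + 1) × ι) (B4.Idx (pbox M) (d + 1) × ι) ℝ :=
  b • (1 : Matrix (B4.Idx (pbox M) (d + 1) × ι) (B4.Idx (pbox M) (d + 1) × ι) ℝ) + deltaPol M n ⊗ₖ (1 : Matrix ι ι ℝ) + exDress b (deltaPol M n ⊗ₖ (1 : Matrix ι ι ℝ)) Z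

omit [NeZero n] in
/-- Entries of the site object. [folklore] -/
theorem siteC_apply (Z : Matrix (B4.Idx (pbox M) (d + 1) × ι) (B4.Idx (pbox M) (d + 1) × ι) ℝ) (p q : B4.Idx (pbox M) (d + 1) × ι) :
    siteC M ι n b Z p q = b * (1 : Matrix (B4.Idx (pbox M) (d + 1) × ι) (B4.Idx (pbox M) (d + 1) × ι) ℝ) p q + (deltaPol M n ⊗ₖ (1 : Matrix ι ι ℝ)) p q +
      exDress b (deltaPol M n ⊗ₖ (1 : Matrix ι ι ℝ)) Z p q := by
  simp only [siteC, Matrix.add_apply, Matrix.smul_apply, smul_eq_mul]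

/-- `(b·1 + Δ^{(n)} ⊗ₖ 1)⁻¹ = unitBondMatC ((Q_nG_nQ_n*) ⊗ 1_ι)` — (G)'s (1.102)–(1.103) identity with colour, inverted (`n ≥ 1`, `b > 0`). [cite: Balaban1984PropagatorsI, (1.102)–(1.103) p.34] -/
theorem inv_smul_one_add_deltaCol (hn : 1 ≤ n) (hb : 0 < b) :
    (b • (1 : Matrix (B4.Idx (pbox M) (d + 1) × ι) (B4.Idx (pbox M) (d + 1) × ι) ℝ) + deltaPol M n ⊗ₖ (1 : Matrix ι ι ℝ))⁻¹ = unitBondMatC M ι (tensorId ι (sOp M n b)) := by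
  rw [← deltaCol_eq_smul_one_add]
  exact Matrix.inv_eq_left_inv (unitBondMatC_sOp_mul_deltaCol M ι n b hn hb)

/-- `b·1 + Δ^{(n)} ⊗ₖ 1` has a unit determinant (two-sided inverse from (G)). [folklore] -/
theorem isUnit_det_smul_one_add_deltaCol (hn : 1 ≤ n) (hb : 0 < b) :
    IsUnit (b • (1 : Matrix (B4.Idx (pbox M) (d + 1) × ι) (B4.Idx (pbox M) (d + 1) × ι) ℝ) + deltaPol M n ⊗ₖ (1 : Matrix ι ι ℝ)).det := by
  rw [← deltaCol_eq_smul_one_add]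
  exact Matrix.isUnit_det_of_left_inverse (unitBondMatC_sOp_mul_deltaCol M ι n b hn hb)

/-- ★★ **THE HONEST DICTIONARY — THE COLOURED SITE OBJECT IS `(Sym Q X Q*)⁻¹` COLOUR BY COLOUR**: for ANY operator `X` on the coloured fine 1-forms (`n ≥ 1`, `b > 0`),
`siteC M ι n b (unitBondMatC((Q⊗1)∘(X − G⊗1)∘(Q*⊗1))) = (Sym unitBondMatC((Q⊗1)∘X∘(Q*⊗1)))⁻¹` — Bałaban's map `E ↦ (QEQ*)⁻¹` ((1.102)–(1.103)) at `E = X`, symmetrised in the bond basis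
(`(Q⊗1)(G⊗1)(Q*⊗1) = (QGQ*)⊗1` is symmetric with inverse `(b·1 + Δ)⊗1`, (G)).  At `X =` a dressed propagator `G(U) ⊗…` this is the [B9] (3.132)-type site object `(QG(U)Q*)⁻¹`, model level.
[cite: Balaban1984PropagatorsI, (1.102)–(1.103) p.34; Balaban1985BackgroundPropagators, (3.132) p.422 (object, shape)] -/
theorem siteC_eq_inv_symPart (hn : 1 ≤ n) (hb : 0 < b) (X : ((Tor (fine n M) × Fin (d + 1)) × ι → ℝ) →ₗ[ℝ] ((Tor (fine n M) × Fin (d + 1)) × ι → ℝ)) :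
    siteC M ι n b (unitBondMatC M ι (tensorId ι (qvRe M n) ∘ₗ (X - tensorId ι (gOp M n b)) ∘ₗ tensorId ι (qvAdjRe M n))) =
      (symPart (unitBondMatC M ι (tensorId ι (qvRe M n) ∘ₗ X ∘ₗ tensorId ι (qvAdjRe M n))))⁻¹ := by
  have hS : tensorId ι (qvRe M n) ∘ₗ tensorId ι (gOp M n b) ∘ₗ tensorId ι (qvAdjRe M n) = tensorId ι (sOp M n b) := by
    rw [sOp_def]; exact LinearMap.ext fun f => funext fun p => rfl
  have hsplit : tensorId ι (qvRe M n) ∘ₗ X ∘ₗ tensorId ι (qvAdjRe M n) =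
      tensorId ι (qvRe M n) ∘ₗ tensorId ι (gOp M n b) ∘ₗ tensorId ι (qvAdjRe M n) + tensorId ι (qvRe M n) ∘ₗ (X - tensorId ι (gOp M n b)) ∘ₗ tensorId ι (qvAdjRe M n) := by
    simp only [LinearMap.comp_sub, LinearMap.sub_comp]
    abel
  have hsym : (unitBondMatC M ι (tensorId ι (sOp M n b))).IsSymm := by
    rw [unitBondMatC_tensorId]; exact kron_one_isSymm ι (unitBondMat_sOp_isSymm M n hn hb)
  -- `Sym (S + Z) = S + Sym Z` for the symmetric `S`
  have hsymPart : symPart (unitBondMatC M ι (tensorId ι (sOp M n b)) + unitBondMatC M ι (tensorId ι (qvRe M n) ∘ₗ (X - tensorId ι (gOp M n b)) ∘ₗ tensorId ι (qvAdjRe M n))) =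
      unitBondMatC M ι (tensorId ι (sOp M n b)) + symPart (unitBondMatC M ι (tensorId ι (qvRe M n) ∘ₗ (X - tensorId ι (gOp M n b)) ∘ₗ tensorId ι (qvAdjRe M n))) := by
    ext p q
    simp only [symPart_apply, Matrix.add_apply]
    rw [hsym.apply q p]
    ring
  rw [hsplit, unitBondMatC_add, hS, hsymPart, siteC, exDress, inv_smul_one_add_deltaCol M ι n b hn hb, add_sub_cancel]

/-- No middle factor, no dressing: `siteC M ι n b 0 = b·1 + Δ^{(n)} ⊗ₖ 1` (`n ≥ 1`, `b > 0`). [folklore] -/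
theorem siteC_zero (hn : 1 ≤ n) (hb : 0 < b) :
    siteC M ι n b 0 = b • (1 : Matrix (B4.Idx (pbox M) (d + 1) × ι) (B4.Idx (pbox M) (d + 1) × ι) ℝ) + deltaPol M n ⊗ₖ (1 : Matrix ι ι ℝ) := by
  rw [siteC, exDress_zero (isUnit_det_smul_one_add_deltaCol M ι n b hn hb), add_zero]

end Object

/-! ## §2 ★★★ The η-difference letter of the coloured site object from the three letters of the middle factor -/

section Letters

variable (d)

/-- ★★★ **THE η-DIFFERENCE LETTER OF THE COLOURED SITE OBJECT, UNIFORM.**  Let `b > 0`, a middle-factor rate `δ_Z > 0` and a colour bound `N_c`.  There are `C, δ, ζ₀ > 0` (from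
`d, b, δ_Z, N_c`) such that for EVERY unit torus `M`, EVERY colour type `ι` with `|ι| ≤ N_c`, ALL levels `n₁ ≥ 1`, `n₂ = R·n₁` and ALL middle factors `Z, Z′` with `|Z|, |Z′| ≤ ζ·e^{−δ_Z·cdist}`
(`0 ≤ ζ ≤ ζ₀`), `|Z′ − Z| ≤ τ·e^{−δ_Z·cdist}` (`τ ≥ 0`):  `|siteC M ι n₂ b Z′ (p,q) − siteC M ι n₁ b Z (p,q)| ≤ C·(τ + n₁⁻¹)·e^{−δ·cdist(p,q)}` — the `b·1` cancel, King's (1.66) letter ⊗ colour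
((G) `kernelRate166_col`) plus Σ-col (H) `exDress_deltaCol_letters` (iii). [cite: Balaban1984PropagatorsI, (1.66) p.29, (1.103) p.34 (objects); King1986, Lemma 4.5 (4.38)–(4.41) pp.674–675 (mechanism); CombesThomas1973, §II (mechanism)] -/
theorem siteC_sub_letters (Nc : ℕ) {b : ℝ} (hb : 0 < b) {δZ : ℝ} (hδZ : 0 < δZ) :
    ∃ C δ ζ₀ : ℝ, 0 < C ∧ 0 < δ ∧ 0 < ζ₀ ∧
      ∀ (M : Fin (d + 1) → ℕ) [∀ μ, NeZero (M μ)] (ι : Type) [Fintype ι] [DecidableEq ι], Fintype.card ι ≤ Nc →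
      ∀ (n₁ n₂ R : ℕ), 1 ≤ n₁ → 1 ≤ R → n₂ = R * n₁ →
        ∀ (Z Z' : Matrix (B4.Idx (pbox M) (d + 1) × ι) (B4.Idx (pbox M) (d + 1) × ι) ℝ) (ζ τ : ℝ), 0 ≤ ζ → ζ ≤ ζ₀ → 0 ≤ τ →
        (∀ p q : B4.Idx (pbox M) (d + 1) × ι, |Z p q| ≤ ζ * Real.exp (-(δZ * cdist M ι p q))) →
        (∀ p q : B4.Idx (pbox M) (d + 1) × ι, |Z' p q| ≤ ζ * Real.exp (-(δZ * cdist M ι p q))) →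
        (∀ p q : B4.Idx (pbox M) (d + 1) × ι, |Z' p q - Z p q| ≤ τ * Real.exp (-(δZ * cdist M ι p q))) →
        ∀ p q : B4.Idx (pbox M) (d + 1) × ι, |siteC M ι n₂ b Z' p q - siteC M ι n₁ b Z p q| ≤ C * (τ + (n₁ : ℝ)⁻¹) * Real.exp (-(δ * cdist M ι p q)) := by
  obtain ⟨K, δ', ζ₀, hK, hδ', hζ₀, HP⟩ := exDress_deltaCol_letters d Nc hb hδZ
  obtain ⟨θ₀, δ₁, hθ₀, hδ₁, HΔ⟩ := kernelRate166_col d (by omega)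
  refine ⟨θ₀ + K, min δ' δ₁, ζ₀, by positivity, lt_min hδ' hδ₁, hζ₀, ?_⟩
  intro M _ ι _ _ hι n₁ n₂ R hn₁ hR h Z Z' ζ τ hζ hζle hτ hZ hZ' hZZ p q
  obtain ⟨-, -, -, -, hP3⟩ := HP M ι hι n₁ n₂ R hn₁ hR h Z Z' ζ τ hζ hζle hτ hZ hZ' hZZ
  have hΔ := HΔ M ι n₁ n₂ R hn₁ hR h p q
  have hρ0 : 0 ≤ cdist M ι p q := cdist_nonneg M ι p q
  have hn0 : 0 ≤ (n₁ : ℝ)⁻¹ := inv_nonneg.mpr (Nat.cast_nonneg _)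
  have hθn : 0 ≤ θ₀ * (n₁ : ℝ)⁻¹ := by positivity
  have hKn : 0 ≤ K * (τ + (n₁ : ℝ)⁻¹) := by positivity
  have hA := hΔ.trans (exp_decay_mono hθn (min_le_right δ' δ₁) hρ0)
  have hB := (hP3 p q).trans (exp_decay_mono hKn (min_le_left δ' δ₁) hρ0)
  have hE := Real.exp_nonneg (-(min δ' δ₁ * cdist M ι p q))
  rw [siteC_apply, siteC_apply]
  calc _ ≤ θ₀ * (n₁ : ℝ)⁻¹ * Real.exp (-(min δ' δ₁ * cdist M ι p q)) + K * (τ + (n₁ : ℝ)⁻¹) * Real.exp (-(min δ' δ₁ * cdist M ι p q)) := by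
        refine (le_of_eq (congrArg abs ?_)).trans ((abs_add_le _ _).trans (add_le_add hA hB))
        ring
    _ ≤ (θ₀ + K) * (τ + (n₁ : ℝ)⁻¹) * Real.exp (-(min δ' δ₁ * cdist M ι p q)) := by
        have h1 : θ₀ * (n₁ : ℝ)⁻¹ ≤ θ₀ * (τ + (n₁ : ℝ)⁻¹) := mul_le_mul_of_nonneg_left (by linarith) hθ₀.le
        nlinarith [mul_le_mul_of_nonneg_right h1 hE]

end Letters

end Summit.QuantumFields.YangMills.BalabanUVNodes.N15.UnitLayerBgCol

end
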